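import Literature.NumberTheory.Automorphic.SymCoeffLattice
import Literature.NumberTheory.Automorphic.SymPowTensorIwahoriCoefficients
import Literature.NumberTheory.Automorphic.LevelActionMonoidRestriction
import Literature.NumberTheory.Automorphic.LevelActionCoefficientEquiv
import HarnessLib

/-!
# The reduced `𝒪`-lattice coefficients are the coefficients of independence of weight

Topic `NumberTheory/Automorphic`; namespace `Literature.NumberTheory.Automorphic.ParallelWeight`;
definitions with bodies (identifications) and theorems.  Two bookkeeping devices for the SAME
torsion coefficients `⨂_τ Sym^{k−2}(S²)` of `Res_{F/ℚ} GL₂` (`S = 𝒪/ϖ^r`) are identified: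

* the `S`-form `SymCoeffLattice S E F k` of `SymCoeffLattice` (reduction of the `𝒪`-lattice,
  `latticeQuotEquiv`) with the integral action `symLatticeAction S E F k v red` of the integral monoid
  `integralMonoid F v` (`red_τ = φO_τ mod ϖ^r`), and
* the tree's `SymPowTensor S (F →+* E) (k − 2)` with the action `symPowCoeffJ F v red` of the
  multi-place Iwahori monoid `multiIwahoriMonoid F v red ≤ integralMonoid F v`
  (`SymPowTensorIwahoriCoefficients`, the input of `HidaIndependenceOfWeightTensor`).

`latticeEquivTensor` is the (definitional) identification of the modules, `symLatticeActionT` the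
transported action, `symPowCoeffJ_eq_symLatticeActionT` the agreement of the actions on the smaller
monoid, and **`cohomologyIsoLatticeTensor : H^i(U, symPowCoeffJ) ≅ H^i(U, symLatticeAction)`**
(`LevelActionMonoidRestriction` + `LevelActionCoefficientEquiv`) with Hecke and ordinary-part
compatibility (`cohomologyIsoLatticeTensor_hom_comp_heckeCohomology`,
`bijOn_ordinaryPart_latticeTensor`). [cite: KhareThorne2017, §6.4] [cite: Hida1994AIF, §1–§2]

## References

* C. Khare, J. A. Thorne, Amer. J. Math. 139 (2017), §6.4 (arXiv:1409.7007, held). [KhareThorne2017]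
* H. Hida, Ann. Inst. Fourier 44 (1994), §1–§2 (held). [Hida1994AIF]
-/

noncomputable section

open CategoryTheory IsDedekindDomain NumberField

namespace Literature.NumberTheory.Automorphic

/-- Inverting an intertwining relation along an isomorphism of modules: `e ∘ T = T' ∘ e` gives
`e⁻¹ ∘ T' = T ∘ e⁻¹`. [folklore] -/
theorem inv_hom_comp_eq_of_hom_comp_eq {R : Type*} [Ring R] {A B : ModuleCat R} (e : A ≅ B)
    {T : A →ₗ[R] A} {T' : B →ₗ[R] B} (h : e.hom.hom ∘ₗ T = T' ∘ₗ e.hom.hom) :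
    e.inv.hom ∘ₗ T' = T ∘ₗ e.inv.hom := by
  refine LinearMap.ext fun y => ?_
  have hinv : ∀ z, e.hom.hom (e.inv.hom z) = z := fun z => by
    change (e.inv ≫ e.hom).hom z = z
    rw [e.inv_hom_id]
    rfl
  have hinv' : ∀ z, e.inv.hom (e.hom.hom z) = z := fun z => by
    change (e.hom ≫ e.inv).hom z = z
    rw [e.hom_inv_id]
    rfl
  have h1 := LinearMap.congr_fun h (e.inv.hom y)
  simp only [LinearMap.coe_comp, Function.comp_apply, hinv] at h1
  simp only [LinearMap.coe_comp, Function.comp_apply]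
  rw [← h1, hinv']

namespace ParallelWeight

open BigHeckeGLn IntegralWeightGL2 LevelAction

variable (S : Type) [CommRing S] (E : Type) [Field E] (F : Type) [Field F] [NumberField F] (k : ℕ)
  (v : (F →+* E) → HeightOneSpectrum (𝓞 F)) (red : ∀ τ : F →+* E, (v τ).adicCompletionIntegers F →+* S)

/-! ### The modules -/

/-- **`SymCoeffLattice S E F k = SymPowTensor S (F →+* E) (k − 2)`** (both are
`⨂[S]_τ Sym^{k−2}(S²)`; the identity, as a linear equivalence between the two wrappers). [folklore] -/
def latticeEquivTensor : SymCoeffLattice S E F k ≃ₗ[S] SymPowTensor S (F →+* E) (fun _ => k - 2) :=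
  LinearEquiv.refl S (SymCoeffLattice S E F k)

omit [NumberField F] in
/-- `latticeEquivTensor` on pure tensors. [folklore] -/
@[simp]
theorem latticeEquivTensor_ltprod (x : (F →+* E) → SymPow S (k - 2)) :
    latticeEquivTensor S E F k (ltprod x) = SymPowTensor.tprod x :=
  rfl

/-! ### The monoids and the actions -/

variable {S E F} in
/-- **`multiIwahoriMonoid ≤ integralMonoid`** (the Iwahori condition includes integrality). [folklore] -/
theorem multiIwahoriMonoid_le_integralMonoid :
    multiIwahoriMonoid F v red ≤ integralMonoid F v := fun g hg =>
  (mem_integralMonoid_iff g).2 fun τ => (mem_multiIwahoriMonoid_iff.1 hg τ).1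

/-- The integral action of `SymCoeffLattice`, on the `SymPowTensor` wrapper. [folklore] -/
def symLatticeActionT : integralMonoid F v →* Module.End S (SymPowTensor S (F →+* E) (fun _ => k - 2)) :=
  symLatticeAction S E F k v red

/-- `latticeEquivTensor` is equivariant (definitionally). [folklore] -/
theorem latticeEquivTensor_equivariant (δ : integralMonoid F v) :
    (latticeEquivTensor S E F k : SymCoeffLattice S E F k →ₗ[S] SymPowTensor S (F →+* E) (fun _ => k - 2)) ∘ₗ
        symLatticeAction S E F k v red δ =
      symLatticeActionT S E F k v red δ ∘ₗ
        (latticeEquivTensor S E F k : SymCoeffLattice S E F k →ₗ[S] SymPowTensor S (F →+* E) (fun _ => k - 2)) :=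
  rfl

/-- `symLatticeActionT` on pure tensors. [folklore] -/
theorem symLatticeActionT_tprod (g : integralMonoid F v) (x : (F →+* E) → SymPow S (k - 2)) :
    symLatticeActionT S E F k v red g (SymPowTensor.tprod x) =
      SymPowTensor.tprod fun τ => symPowAction S (k - 2) (intMatrixAt S F v red τ g) (x τ) :=
  symLatticeAction_tprod S E F k v red g x

/-- **The actions agree on the multi-place Iwahori monoid**: `symPowCoeffJ g = symLatticeAction g`
(both act on the `τ`-th factor through `red_τ(g_{v(τ)})`). [cite: KhareThorne2017, §6.4] -/
theorem symPowCoeffJ_eq_symLatticeActionT (g : FiniteAdelicGL 2 F) (hg : g ∈ multiIwahoriMonoid F v red) :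
    symPowCoeffJ F v red (fun _ => k - 2) ⟨g, hg⟩ =
      symLatticeActionT S E F k v red ⟨g, multiIwahoriMonoid_le_integralMonoid v red hg⟩ := by
  refine SymPowTensor.hom_ext fun x => ?_
  rw [symPowCoeffJ_apply_tprod, symLatticeActionT_tprod]
  rfl

/-! ### The cohomology -/

variable {Γ : Type} [Group Γ] (ι : Γ →* FiniteAdelicGL 2 F) {U : Subgroup (FiniteAdelicGL 2 F)}
  (hU : U.toSubmonoid ≤ multiIwahoriMonoid F v red) (i : ℕ)

/-- **`H^i(U, symPowCoeffJ) ≅ H^i(U, symLatticeAction)`** (restriction of the monoid, then the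
definitional identification of the coefficient wrappers). [cite: KhareThorne2017, §6.4] -/
def cohomologyIsoLatticeTensor :
    LevelAction.cohomology ι (multiIwahoriMonoid F v red) (symPowCoeffJ F v red (fun _ => k - 2)) U i ≅
      LevelAction.cohomology ι (integralMonoid F v) (symLatticeAction S E F k v red) U i :=
  cohomologyIsoOfRestrict ι (multiIwahoriMonoid_le_integralMonoid v red)
      (symPowCoeffJ_eq_symLatticeActionT S E F k v red) hU i ≪≫
    (cohomologyIsoOfCoeffEquiv ι (integralMonoid F v) (symLatticeAction S E F k v red)
      (symLatticeActionT S E F k v red) U (latticeEquivTensor S E F k)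
      (latticeEquivTensor_equivariant S E F k v red) i).symm

/-- **Hecke compatibility of `cohomologyIsoLatticeTensor`** for `α` in the multi-place Iwahori monoid
(e.g. `U_p^{(r)}`, `T_w`, the diamonds). [folklore] -/
theorem cohomologyIsoLatticeTensor_hom_comp_heckeCohomology {α : FiniteAdelicGL 2 F}
    (hα : α ∈ multiIwahoriMonoid F v red) :
    (cohomologyIsoLatticeTensor S E F k v red ι hU i).hom.hom ∘ₗ
        heckeCohomology ι (multiIwahoriMonoid F v red) (symPowCoeffJ F v red (fun _ => k - 2)) U hU hα i =
      heckeCohomology ι (integralMonoid F v) (symLatticeAction S E F k v red) U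
          (hU.trans (multiIwahoriMonoid_le_integralMonoid v red))
          (multiIwahoriMonoid_le_integralMonoid v red hα) i ∘ₗ
        (cohomologyIsoLatticeTensor S E F k v red ι hU i).hom.hom := by
  have h₁ := cohomologyIsoOfRestrict_hom_comp_heckeCohomology ι (multiIwahoriMonoid_le_integralMonoid v red)
    (symPowCoeffJ_eq_symLatticeActionT S E F k v red) hU hα i
  have h₂ := inv_hom_comp_eq_of_hom_comp_eq _
    (cohomologyIsoOfCoeffEquiv_hom_comp_heckeCohomology ι (integralMonoid F v)
      (symLatticeAction S E F k v red) (symLatticeActionT S E F k v red) U (latticeEquivTensor S E F k)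
      (latticeEquivTensor_equivariant S E F k v red) (hU.trans (multiIwahoriMonoid_le_integralMonoid v red))
      (multiIwahoriMonoid_le_integralMonoid v red hα) i)
  rw [cohomologyIsoLatticeTensor, Iso.trans_hom, Iso.symm_hom, ModuleCat.hom_comp, LinearMap.comp_assoc, h₁,
    ← LinearMap.comp_assoc, h₂, LinearMap.comp_assoc]

/-- **The `[U α U]`-ordinary parts correspond under `cohomologyIsoLatticeTensor`.** [folklore] -/
theorem bijOn_ordinaryPart_latticeTensor {α : FiniteAdelicGL 2 F} (hα : α ∈ multiIwahoriMonoid F v red) :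
    Set.BijOn (cohomologyIsoLatticeTensor S E F k v red ι hU i).hom.hom
      (⨅ n : ℕ, LinearMap.range (heckeCohomology ι (multiIwahoriMonoid F v red)
        (symPowCoeffJ F v red (fun _ => k - 2)) U hU hα i ^ n) : Submodule S _)
      (⨅ n : ℕ, LinearMap.range (heckeCohomology ι (integralMonoid F v) (symLatticeAction S E F k v red) U
        (hU.trans (multiIwahoriMonoid_le_integralMonoid v red))
        (multiIwahoriMonoid_le_integralMonoid v red hα) i ^ n) : Submodule S _) :=
  bijOn_iInf_range_pow_of_linearEquiv (cohomologyIsoLatticeTensor S E F k v red ι hU i).toLinearEquiv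
    (cohomologyIsoLatticeTensor_hom_comp_heckeCohomology S E F k v red ι hU i hα)

end ParallelWeight

end Literature.NumberTheory.Automorphic
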